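import Literature.MathematicalPhysics.QuantumFieldTheory.Balaban1983to89.B7Eq78Linearization
import Literature.MathematicalPhysics.QuantumFieldTheory.Balaban1983to89.B8Eq119TwistedAxial
import Literature.MathematicalPhysics.QuantumFieldTheory.Balaban1983to89.B7Prop6Flat
import Literature.MathematicalPhysics.QuantumFieldTheory.Balaban1983to89.B8Eq115GaugeFixing
import Summits.QuantumFields.YangMills.Theorems.UnitScaleTiltProp7SPrintDefs
import Summits.QuantumFields.YangMills.Theorems.UnitScaleTiltProp7AxialReprPrint
import Summits.QuantumFields.YangMills.Theorems.UnitScaleTiltProp7TwistRegauge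
import HarnessLib

/-!
# S2β · THE (1.29)-CORNER IDENTITY — a (1.29)-RESTRICTED gauge transformation that splits as `u = p·q⁻¹` with `p • W` AXIAL relative to `W` ((1.19)) and
# `q ∈ Stab(W)` is `1` AT EVERY `k`-FOLD BLOCK CORNER, hence descends to the identity on the comparison lattice (`u↓ = 1`)

Cell `ym3-torus` (YM ladder rung R3 = continuum `SU(2)` Yang–Mills on the three-torus at fixed lattice data — a RUNG: NOT d = 4, NOT infinite volume, NOT a
mass gap, NOT Clay).  Width seat `ym3-torus-px13` (gen 21; lineage: px13 g4 `Prop7SigmaRepOfThm2S`, px13 g20 brick 1 ✓p801522 `…S2BetaSigmaRepSplit`), FILE A of the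
pen «`hlift` for free from (1.29)»; crux `stmt-QuantumFields-20520` (`…Theses.UnitScaleTilt.FluctuationComparisonRegPrIntL`), LINE g18-1 S2β, organ GAP♯∘ ∕ the per-datum
GAP♭ board; `--kind proof --supports stmt-QuantumFields-20520 --as helper`, count-neutral, DEFINITION-FREE (0 `def`, 0 `instance`, 0 `notation`, 0 `sorry`, default heartbeats).

WHY.  The consumers of the per-datum board (✓px17 pen 7 `atMostOneCriticalOrbit_of_el_symmetriesLift_five`, ✓px17 FILE 1 `gapFlat_at_min_of_lift_five`) need ONE row at a
critical regular point `W` over a datum `V`: «every symmetry `s` of `V` lifts to a symmetry `k` of `W` with `k↓ = s`» (`hlift`).  FILE B derives it with NO analytic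
letter from the structured Σ-representation `v • (κ • W) = u • W` of the moved critical point `κ • W` (`κ↓ = s`; brick 1: `v = 1` at the `k`-centres, `u` (1.29)-restricted,
`v • (κ • W)` in the iterated axial gauge (1.19) relative to `W`) — PROVIDED `u↓ = 1`.  THIS FILE proves that proviso from the DEFINITION of the restriction (1.29)
([Balaban1985Averaging] (78)–(81): the `j`-fold twisted block averages `R̄₀uʲ` of `u`): writing `u = p·q⁻¹` with `p := vκ` (so `p • W` is axial) and `q := u⁻¹vκ ∈ Stab(W)`,
(F1) `R̄₀(u·q)ⁿ(y) = R̄₀(u)ⁿ(y)·q(Lⁿy)` for every `q` that is PARALLEL along the block contours of the averaged backgrounds `W̄ᵐ`, `m < n` (the terms under the bar are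
conjugated by the constant `q(Lⁿ⁺¹y)`, and `log`, `Σ`, `exp` commute with conjugation — the series logarithm UNCONDITIONALLY, lit ✓`B7Prop6Flat.mlog_conj`);
(F2) = (F1) at `u = 1`: `R̄₀(p)ⁿ(y) = p(Lⁿy)`; a stabiliser of `W` is contour-parallel at every level (gauge covariance of the averaging, lit ✓`avgIter_gaugeAct_units`), and
`p • W ∈ Ax_k(𝔅_k, W)` says EXACTLY that `p` is contour-parallel inside every block at the levels `< k` (lit ✓`inAx_iff`: «`W̄ⁿ(Γ) = Ū₀ⁿ(Γ)` on every block contour»).  Hence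
`R̄₀(u)ᵏ(y) = p(Lᵏy)·q(Lᵏy)⁻¹ = u(Lᵏy)`, and (1.29) at its only live level `j = k` (`Λ_k = T^{(k)}`, lit `torusLam`) reads `u(Lᵏy) = 1` for every `y`.  On the T³ carrier
(§4) the `ℤᵈ` letters are read on the pullbacks BASED at `x₀ = embIter k 0`, whose block corners `Lᵏz` ARE the `k`-centres (✓`embIter_eq_transl`), so `u = 1` at every
`(K−n)`-centre and `u↓ = 1`.

WHAT IS PROVED (sorry-free; `𝔸` a complete normed `ℂ`-algebra in §1–§3, `M₂(ℂ)` with the `L²`-operator norm in §4).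
* §1 `isUnit_exp_C`, `barAvg_units_conj` (via lit ✓`B7Prop6Flat.mlog_conj`, no disc hypothesis), `barAvg_congr`, `isUnit_avgStep`, `isUnit_Rbar`,
  ★★★ `Rbar_mul_parallel` (F1) and `Rbar_parallel` (F2) on the ABSTRACT `B7Eq78Linearization.Blocking` (any blocks, base points, weights, transporters).
* §2 `exists_under`, `exists_boxVec_of_mem_blockSites`, ★ `contourParallel_of_gaugeAct_eq` (stabiliser ⇒ parallel at every level), ★ `contourParallel_of_inAx` ((1.19) ⇒ parallel in blocks, levels `< k`).
* §3 ★★★ `restr129_corner_eq_one` — `Restr129 L k (torusLam k) U₀ u ∧ InAx L k (torusLam k) U₀ (gaugeAct p U₀) ∧ gaugeAct q U₀ = U₀ ∧ u = p·q⁻¹ ⟹ u (Lᵏ·y) = 1`.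
* §4 ★★★★ `eq_one_embIter_of_restrictedPrint_split` ∕ `descTransf_eq_one_of_restrictedPrint_split` — at the T³ carrier: `RestrictedPrint F n K W u ∧ IsAxialPrint F n K W (p • W) ∧
  k • W = W ∧ u = p·k⁻¹ ⟹ u (embIter (K−n) y) = 1 ∀ y`, hence `descTransf F n K h u = 1`.

HONEST.  Kinematics of the tree's own letters (78)–(80) ∕ (1.19) ∕ (1.29) and the based-pullback dictionary; no estimate; nothing of Bałaban's analysis asserted or proved;
`hlift`, Prop. 7 cl. 1, GAP♭ (FILE B), TUBE-REG∘'s uniform order, GAP♯∘ as registered, EXW∘, S2β, the five registered ∘-stubs, 20520, 19936, 19200, `YM3TorusSU2` NOT proved;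
rung R3 = SU(2) YM₃ on T³ at fixed lattice data — NOT d = 4, NOT infinite volume, NOT a mass gap, NOT Clay; the Yang–Mills mass gap is NOT proved.  Axioms standard.

References: T. Bałaban, CMP **98** (1985) 17–51 [Balaban1985Averaging] ((8)–(13) p.19, (21)–(23) p.21, (78)–(81) p.30); CMP **99** (1985) 75–102 [Balaban1985RegularSpaces]
((1.14) p.78, (1.19) p.79, (1.29) p.81, Thm 2 p.83); CMP **102** (1985) 277–309 [Balaban1985Variational] ((4)–(6) p.278, Prop. 2 p.281, Prop. 7 p.299); [Balaban1987RG1] ((0.1) p.251).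
-/

set_option autoImplicit false

noncomputable section

open scoped BigOperators
open NormedSpace Finset

namespace Summit.QuantumFields.YangMills.Theorems.FluctuationComparisonRegPrIntLS2BetaRestr129OfParallelSplit

open Literature.MathematicalPhysics.QuantumFieldTheory.Balaban1983to89
open MatrixLog (mlog)
open B7Prop6Flat (mlog_conj)
open B7BlockAvgLog (barAvg barAvg_eq_exp_sum)
open B7Eq78Linearization (conjR conjR_apply avgStep avgStep_eq_mul_exp_sum Rbar Rbar_zero Rbar_succ Rbar_one Blocking)

/-! ## §1 Conjugation-equivariance of the series logarithm and of the bar average (78); the right-parallel factorisation (F1)∕(F2) of `R̄₀` on an abstract blocking -/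

section Generic

variable {𝔸 : Type*} [NormedRing 𝔸] [NormedAlgebra ℂ 𝔸] [CompleteSpace 𝔸]

/-- `exp x` is a unit (Mathlib's `isUnit_exp` through `NormedAlgebra.restrictScalars ℚ ℂ`). [folklore] -/
theorem isUnit_exp_C (x : 𝔸) : IsUnit (exp x) := by
  letI : NormedAlgebra ℚ 𝔸 := NormedAlgebra.restrictScalars ℚ ℂ 𝔸
  exact isUnit_exp x

/-- **THE BAR AVERAGE (78)∕(82) IS CONJUGATION-EQUIVARIANT**: `{cM_xc⁻¹}‾ = c·{M_x}‾·c⁻¹` for a constant unit `c` — the series log commutes with conjugation with NO disc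
hypothesis (lit ✓`B7Prop6Flat.mlog_conj`), so do the weighted sum and `exp` (Mathlib's `exp_units_conj` through `NormedAlgebra.restrictScalars ℚ ℂ`).
[cite: Balaban1985Averaging, (78) p.30, (23) p.21] -/
theorem barAvg_units_conj {ι : Type*} (t : Finset ι) (wt : ι → ℝ) (c : 𝔸ˣ) (M : ι → 𝔸) :
    barAvg t wt (fun x => (c : 𝔸) * M x * ((c⁻¹ : 𝔸ˣ) : 𝔸)) = (c : 𝔸) * barAvg t wt M * ((c⁻¹ : 𝔸ˣ) : 𝔸) := by
  letI : NormedAlgebra ℚ 𝔸 := NormedAlgebra.restrictScalars ℚ ℂ 𝔸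
  rw [barAvg_eq_exp_sum, barAvg_eq_exp_sum]
  have hsum : ∑ x ∈ t, wt x • mlog ((c : 𝔸) * M x * ((c⁻¹ : 𝔸ˣ) : 𝔸)) =
      (c : 𝔸) * (∑ x ∈ t, wt x • mlog (M x)) * ((c⁻¹ : 𝔸ˣ) : 𝔸) := by
    rw [Finset.mul_sum, Finset.sum_mul]
    refine Finset.sum_congr rfl fun x _ => ?_
    rw [mlog_conj, mul_smul_comm, smul_mul_assoc]
  rw [hsum, exp_units_conj]

/-- The one-step average (78) `v(y)·{…}‾` is a unit as soon as the prefactor `v(y)` is (the bar is an exponential). [cite: Balaban1985Averaging, (78) p.30] -/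
theorem isUnit_avgStep {ι : Type*} (t : Finset ι) (wt : ι → ℝ) (T : ι → 𝔸ˣ) {vy : 𝔸} (hvy : IsUnit vy) (v : ι → 𝔸) :
    IsUnit (avgStep t wt T vy v) := by
  rw [avgStep_eq_mul_exp_sum]
  exact hvy.mul (isUnit_exp_C _)

variable {ι : Type*} (G : Blocking ι) (T : ℕ → ι → ι → 𝔸ˣ)

/-- `R̄₀uⁿ(y)` is a unit for unit-valued `u` ((79)–(80) iterate (78)). [cite: Balaban1985Averaging, (79)-(80) p.30] -/
theorem isUnit_Rbar {u : ι → 𝔸} (hu : ∀ x, IsUnit (u x)) : ∀ (n : ℕ) (y : ι), IsUnit (Rbar G T n u y)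
  | 0, y => by rw [Rbar_zero]; exact hu y
  | n + 1, y => by
    rw [Rbar_succ]
    exact isUnit_avgStep _ _ _ (isUnit_Rbar hu n _) _

omit [CompleteSpace 𝔸] in
/-- The bar average (78) depends only on the values on the block. [cite: Balaban1985Averaging, (78) p.30] -/
theorem barAvg_congr {ι : Type*} (t : Finset ι) (wt : ι → ℝ) {f g : ι → 𝔸} (h : ∀ x ∈ t, f x = g x) :
    barAvg t wt f = barAvg t wt g := by
  rw [barAvg_eq_exp_sum, barAvg_eq_exp_sum, Finset.sum_congr rfl fun x hx => by rw [h x hx]]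

/-- ★★★ **(F1) — THE RIGHT-PARALLEL FACTORISATION OF `R̄₀`** on an abstract blocking (any blocks `B n y`, base points, weights, level transporters `T n y x`): if the
unit-valued level functions `qₙ` are CONTOUR-PARALLEL below level `N` (`T n y x · qₙ(x) · (T n y x)⁻¹ = qₙ₊₁(y)` for `x ∈ B n y`, `n < N`) and read at the base point
(`qₙ₊₁(y) = qₙ(base n y)`), then for every unit-valued `u` and every `n ≤ N`: `R̄₀(u·q₀)ⁿ(y) = R̄₀(u)ⁿ(y)·qₙ(y)`.  Step: the prefactor is `R̄₀uⁿ(b)·qₙ(b)`, each term under the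
bar is the old one conjugated by the constant `qₙ(b)⁻¹` (`T(A_x q_x)T⁻¹ = (TA_xT⁻¹)(Tq_xT⁻¹) = (TA_xT⁻¹)·qₙ₊₁(y)`), and the bar is conjugation-equivariant.
[cite: Balaban1985Averaging, (78)-(80) p.30, (23) p.21, (11) p.19] -/
theorem Rbar_mul_parallel (N : ℕ) {u : ι → 𝔸} (hu : ∀ x, IsUnit (u x)) (q : ℕ → ι → 𝔸ˣ)
    (hpar : ∀ n, n < N → ∀ y, ∀ x ∈ G.B n y, (T n y x : 𝔸) * (q n x : 𝔸) * ((T n y x)⁻¹ : 𝔸ˣ) = q (n + 1) y)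
    (hbase : ∀ n, n < N → ∀ y, q (n + 1) y = q n (G.base n y)) :
    ∀ n, n ≤ N → ∀ y, Rbar G T n (fun x => u x * (q 0 x : 𝔸)) y = Rbar G T n u y * (q n y : 𝔸)
  | 0, _, y => by simp only [Rbar_zero]
  | n + 1, hn, y => by
    have hn' : n < N := Nat.lt_of_succ_le hn
    have IH := Rbar_mul_parallel N hu q hpar hbase n hn'.le
    rw [Rbar_succ, Rbar_succ, avgStep, avgStep]
    set A : ι → 𝔸 := Rbar G T n u with hA
    set b := G.base n y with hb
    set c : 𝔸ˣ := q (n + 1) y with hc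
    have hcb : q n b = c := by rw [hc, hb, hbase n hn' y]
    have IHb : Rbar G T n (fun x => u x * (q 0 x : 𝔸)) b = A b * (c : 𝔸) := by rw [IH, hcb]
    rw [IHb]
    have hAu : IsUnit (A b) := isUnit_Rbar G T hu n b
    obtain ⟨a, ha⟩ := hAu
    -- `Ring.inverse (A b * c) = c⁻¹ * (A b)⁻¹`
    have hinv : Ring.inverse (A b * (c : 𝔸)) = ((c⁻¹ : 𝔸ˣ) : 𝔸) * Ring.inverse (A b) := by
      rw [← ha, ← Units.val_mul, Ring.inverse_unit, Ring.inverse_unit, mul_inv_rev, Units.val_mul]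
    -- the terms under the bar are the old ones conjugated by `c⁻¹`
    have hterm : ∀ x ∈ G.B n y, Ring.inverse (A b * (c : 𝔸)) * conjR (T n y x) (Rbar G T n (fun x => u x * (q 0 x : 𝔸)) x) =
        ((c⁻¹ : 𝔸ˣ) : 𝔸) * (Ring.inverse (A b) * conjR (T n y x) (A x)) * (((c⁻¹)⁻¹ : 𝔸ˣ) : 𝔸) := by
      intro x hx
      have hq : (T n y x : 𝔸) * (q n x : 𝔸) * ((T n y x)⁻¹ : 𝔸ˣ) = c := by rw [hc]; exact hpar n hn' y x hx
      rw [IH, hinv, inv_inv, conjR_apply, conjR_apply]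
      have hsplit : (T n y x : 𝔸) * (A x * (q n x : 𝔸)) * ((T n y x)⁻¹ : 𝔸ˣ) =
          ((T n y x : 𝔸) * A x * ((T n y x)⁻¹ : 𝔸ˣ)) * ((T n y x : 𝔸) * (q n x : 𝔸) * ((T n y x)⁻¹ : 𝔸ˣ)) := by
        simp only [mul_assoc, Units.inv_mul_cancel_left]
      rw [hsplit, hq]
      simp only [mul_assoc]
    rw [barAvg_congr _ _ hterm, barAvg_units_conj, inv_inv]
    -- `A b * c * (c⁻¹ * B * c) = A b * B * c`
    simp only [← mul_assoc, Units.mul_inv_cancel_right]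

/-- **(F2) — `R̄₀` OF A CONTOUR-PARALLEL TRANSFORMATION IS ITS VALUE AT THE BASE POINT**: under (F1)'s hypotheses, `R̄₀(q₀)ⁿ(y) = qₙ(y)` for `n ≤ N`
((F1) at `u = 1` and `R̄₀1 = 1`). [cite: Balaban1985Averaging, (78)-(81) p.30] -/
theorem Rbar_parallel (N : ℕ) (q : ℕ → ι → 𝔸ˣ)
    (hpar : ∀ n, n < N → ∀ y, ∀ x ∈ G.B n y, (T n y x : 𝔸) * (q n x : 𝔸) * ((T n y x)⁻¹ : 𝔸ˣ) = q (n + 1) y)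
    (hbase : ∀ n, n < N → ∀ y, q (n + 1) y = q n (G.base n y)) (n : ℕ) (hn : n ≤ N) (y : ι) :
    Rbar G T n (fun x => (q 0 x : 𝔸)) y = q n y := by
  have h := Rbar_mul_parallel G T N (u := fun _ => (1 : 𝔸)) (fun _ => isUnit_one) q hpar hbase n hn y
  simp only [one_mul] at h
  rw [h, Rbar_one, one_mul]

end Generic

/-! ## §2 The two contour-parallel suppliers on the `ℤᵈ` tower: stabilisers, and (1.19) -/

section Zd

open B7Prop1Explicit renaming Site → LSite
open B7Prop1Explicit (boxVec gaugeAct axialFn)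
open B7Prop2Explicit (avgIter)
open B7AvgGaugeCovariance (uLev uLev_apply uLev_smul)
open B7Prop6Flat (avgIter_gaugeAct_units)
open B8Eq115GaugeFixing (axialFn_gaugeAct)
open B8Eq119TwistedAxial (InAx inAx_iff Restr129 bgT blockBase_eq_smul)
open B8Ineq132 (Under)
open B8Thm4TorusAt (torusLam mem_torusLam_iff)
open B7Eq78Linearization (zdBlocking)
open Literature.MathematicalPhysics.QuantumLattice (blockBase blockSites)

variable {d : ℕ} {𝔸 : Type*} [NormedRing 𝔸] [NormedAlgebra ℂ 𝔸] [CompleteSpace 𝔸]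

/-- Every site of the `m`-times finer lattice lies in the `m`-fold block of some site: `z ∈ Bᵐ(x)` with `x_i = ⌊z_i ∕ Lᵐ⌋` (`L ≥ 1`).
[cite: Balaban1985RegularSpaces, p.79 («x₀ ∈ Bʲ(x_j)»)] -/
theorem exists_under {L : ℕ} (hL : 0 < L) (m : ℕ) (z : LSite d) : ∃ x : LSite d, Under L m x z := by
  have hM : (0 : ℤ) < (L : ℤ) ^ m := by positivity
  refine ⟨fun i => z i / (L : ℤ) ^ m, fun i => ?_⟩
  show (L : ℤ) ^ m * (z i / (L : ℤ) ^ m) ≤ z i ∧ z i + 1 ≤ (L : ℤ) ^ m * (z i / (L : ℤ) ^ m + 1)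
  have h1 := Int.emod_add_mul_ediv (z i) ((L : ℤ) ^ m)
  have h2 := Int.emod_nonneg (z i) hM.ne'
  have h3 := Int.emod_lt_of_pos (z i) hM
  constructor
  · linarith
  · linarith [mul_add ((L : ℤ) ^ m) (z i / (L : ℤ) ^ m) 1]

omit [NormedAlgebra ℂ 𝔸] [CompleteSpace 𝔸] in
/-- The points of the corner block `B(z) = Lz + [0, L)ᵈ` are the `Lz + r`, `r ∈ [0, L)ᵈ`. [cite: Balaban1985Averaging, (2) p.17] -/
theorem exists_boxVec_of_mem_blockSites {L : ℕ} {z x : LSite d} (hx : x ∈ blockSites L z) :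
    ∃ r : Fin d → Fin L, x = (L : ℤ) • z + boxVec L r := by
  classical
  simp only [blockSites, Finset.mem_image, Fintype.mem_piFinset, Finset.mem_range] at hx
  obtain ⟨t, ht, rfl⟩ := hx
  refine ⟨fun i => ⟨t i, ht i⟩, ?_⟩
  rw [blockBase_eq_smul]
  rfl

/-- ★ **A STABILISER IS CONTOUR-PARALLEL AT EVERY LEVEL**: if `U₀^q = U₀` then `Ū₀ⁿ(Γ_{Lz,x})·q(Lⁿx)·Ū₀ⁿ(Γ_{Lz,x})⁻¹ = q(Lⁿ⁺¹z)` for every level `n`, block corner `Lz`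
and site `x` (gauge covariance of the averaging `(Ū^q)ⁿ = (Ūⁿ)^{qₙ}`, lit ✓`avgIter_gaugeAct_units`, and of the contour transporters, lit ✓`axialFn_gaugeAct`;
`bgT L U₀ n z x = Ū₀ⁿ(Γ_{Lz,x})`). [cite: Balaban1985Averaging, (8) p.18, (11) p.19, (43) p.24, (78)-(80) p.30] -/
theorem contourParallel_of_gaugeAct_eq (L : ℕ) {q : LSite d → 𝔸ˣ} {U₀ : LSite d → Fin d → 𝔸ˣ}
    (h : gaugeAct q U₀ = U₀) (n : ℕ) (z x : LSite d) :
    (bgT L U₀ n z x : 𝔸) * ((uLev L q n x : 𝔸ˣ) : 𝔸) * (((bgT L U₀ n z x)⁻¹ : 𝔸ˣ) : 𝔸) = ((uLev L q (n + 1) z : 𝔸ˣ) : 𝔸) := by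
  have hn := avgIter_gaugeAct_units L q U₀ n
  rw [h] at hn
  have hx : axialFn (avgIter L U₀ n) (blockBase L z) x = axialFn (gaugeAct (uLev L q n) (avgIter L U₀ n)) (blockBase L z) x := by
    rw [← hn]
  rw [axialFn_gaugeAct, blockBase_eq_smul, uLev_smul] at hx
  -- `T = a T b⁻¹` in the group `𝔸ˣ` ⇒ `T b T⁻¹ = a`
  have hT : bgT L U₀ n z x * uLev L q n x * (bgT L U₀ n z x)⁻¹ = uLev L q (n + 1) z := by
    have h1 : bgT L U₀ n z x = uLev L q (n + 1) z * bgT L U₀ n z x * (uLev L q n x)⁻¹ := by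
      rw [bgT, blockBase_eq_smul]; exact hx
    calc bgT L U₀ n z x * uLev L q n x * (bgT L U₀ n z x)⁻¹
        = (uLev L q (n + 1) z * bgT L U₀ n z x * (uLev L q n x)⁻¹) * uLev L q n x * (bgT L U₀ n z x)⁻¹ := by rw [← h1]
      _ = uLev L q (n + 1) z := by group
  have := congrArg (fun g : 𝔸ˣ => (g : 𝔸)) hT
  simpa only [Units.val_mul] using this

/-- ★ **(1.19) SAYS THE GAUGE TRANSFORMATION IS CONTOUR-PARALLEL INSIDE THE BLOCKS**: if `U₀^p ∈ Ax_k(𝔅_k, U₀)` with the all-torus constraint sets (`Λ_k = T^{(k)}`, lit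
`torusLam`), then for every level `n < k`, corner `Lz` and `x ∈ B(z)`: `Ū₀ⁿ(Γ_{Lz,x})·p(Lⁿx)·Ū₀ⁿ(Γ_{Lz,x})⁻¹ = p(Lⁿ⁺¹z)` — (1.19) is «`(Ū₀^p)ⁿ(Γ) = Ū₀ⁿ(Γ)` on every block
contour below `T^{(k)}`» (lit ✓`inAx_iff`), and `(Ū₀^p)ⁿ(Γ_{Lz,x}) = p(Lⁿ⁺¹z)·Ū₀ⁿ(Γ_{Lz,x})·p(Lⁿx)⁻¹`. [cite: Balaban1985RegularSpaces, (1.19)-(1.20) p.79; Balaban1985Averaging, (8) p.18, (11) p.19] -/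
theorem contourParallel_of_inAx (L k : ℕ) (hL : 0 < L) {p : LSite d → 𝔸ˣ} {U₀ : LSite d → Fin d → 𝔸ˣ}
    (h : InAx L k (torusLam k) U₀ (gaugeAct p U₀)) (n : ℕ) (hn : n < k) (z x : LSite d) (hx : x ∈ blockSites L z) :
    (bgT L U₀ n z x : 𝔸) * ((uLev L p n x : 𝔸ˣ) : 𝔸) * (((bgT L U₀ n z x)⁻¹ : 𝔸ˣ) : 𝔸) = ((uLev L p (n + 1) z : 𝔸ˣ) : 𝔸) := by
  rw [inAx_iff] at h
  obtain ⟨xj, hxj⟩ := exists_under hL (k - (n + 1)) z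
  obtain ⟨r, rfl⟩ := exists_boxVec_of_mem_blockSites hx
  have h19 := h k (by omega) le_rfl xj ((mem_torusLam_iff k k xj).2 rfl) n hn z hxj r
  rw [avgIter_gaugeAct_units, axialFn_gaugeAct, uLev_smul] at h19
  have hT : bgT L U₀ n z ((L : ℤ) • z + boxVec L r) * uLev L p n ((L : ℤ) • z + boxVec L r) * (bgT L U₀ n z ((L : ℤ) • z + boxVec L r))⁻¹
      = uLev L p (n + 1) z := by
    have h1 : uLev L p (n + 1) z * bgT L U₀ n z ((L : ℤ) • z + boxVec L r) * (uLev L p n ((L : ℤ) • z + boxVec L r))⁻¹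
        = bgT L U₀ n z ((L : ℤ) • z + boxVec L r) := by
      rw [bgT, blockBase_eq_smul]; exact h19
    calc bgT L U₀ n z ((L : ℤ) • z + boxVec L r) * uLev L p n ((L : ℤ) • z + boxVec L r) * (bgT L U₀ n z ((L : ℤ) • z + boxVec L r))⁻¹
        = (uLev L p (n + 1) z * bgT L U₀ n z ((L : ℤ) • z + boxVec L r) * (uLev L p n ((L : ℤ) • z + boxVec L r))⁻¹)
            * uLev L p n ((L : ℤ) • z + boxVec L r) * (bgT L U₀ n z ((L : ℤ) • z + boxVec L r))⁻¹ := by rw [h1]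
      _ = uLev L p (n + 1) z := by group
  have := congrArg (fun g : 𝔸ˣ => (g : 𝔸)) hT
  simpa only [Units.val_mul] using this

/-! ## §3 The (1.29)-CORNER IDENTITY: a (1.29)-restricted `u = p·q⁻¹` with `p • U₀` axial and `q ∈ Stab(U₀)` is `1` at every `k`-fold corner -/

/-- ★★★ **THE (1.29)-CORNER IDENTITY ON THE `ℤᵈ` TOWER**: a (1.29)-restricted `u` (`R̄₀uʲ = 1` on `Λ_j`, all-torus: only `j = k` is live) that splits as `u = p·q⁻¹` with
`U₀^p ∈ Ax_k(𝔅_k, U₀)` and `U₀^q = U₀` satisfies `u(Lᵏ·y) = 1` at EVERY `k`-fold corner: by (F1) for the stabiliser `q⁻¹` (parallel at every level) and (F2) for the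
axial `p` (parallel at the levels `< k`), `1 = R̄₀(u)ᵏ(y) = p(Lᵏy)·q(Lᵏy)⁻¹ = u(Lᵏy)`. [cite: Balaban1985RegularSpaces, (1.29) p.81, (1.19) p.79, (1.14) p.78; Balaban1985Averaging, (78)-(81) p.30] -/
theorem restr129_corner_eq_one (L k : ℕ) (hL : 0 < L) {U₀ : LSite d → Fin d → 𝔸ˣ} {u p q : LSite d → 𝔸ˣ}
    (h129 : Restr129 L k (torusLam k) U₀ u) (hax : InAx L k (torusLam k) U₀ (gaugeAct p U₀)) (hq : gaugeAct q U₀ = U₀)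
    (hu : ∀ x, u x = p x * (q x)⁻¹) (y : LSite d) : u (((L : ℤ) ^ k) • y) = 1 := by
  have h1 : B7Eq78Linearization.Rbar (zdBlocking d L) (bgT L U₀) k (fun x => ((u x : 𝔸ˣ) : 𝔸)) y = 1 :=
    h129 k le_rfl y ((mem_torusLam_iff k k y).2 rfl)
  -- split `u = p · q⁻¹` under `R̄₀`
  have hsplit : (fun x => ((u x : 𝔸ˣ) : 𝔸)) = fun x => ((uLev L p 0 x : 𝔸ˣ) : 𝔸) * (((uLev L q 0 x)⁻¹ : 𝔸ˣ) : 𝔸) := by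
    funext x; rw [hu x, Units.val_mul, B7AvgGaugeCovariance.uLev_zero, B7AvgGaugeCovariance.uLev_zero]
  rw [hsplit] at h1
  -- (F1) with the stabiliser `q⁻¹` (contour-parallel at every level), then (F2) with the axial `p` (levels `< k`)
  have hparq : ∀ n, n < k → ∀ y' : LSite d, ∀ x ∈ (zdBlocking d L).B n y',
      (bgT L U₀ n y' x : 𝔸) * (((uLev L q n x)⁻¹ : 𝔸ˣ) : 𝔸) * (((bgT L U₀ n y' x)⁻¹ : 𝔸ˣ) : 𝔸) = (((uLev L q (n + 1) y')⁻¹ : 𝔸ˣ) : 𝔸) := by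
    intro n _ y' x _
    have h0 : bgT L U₀ n y' x * (uLev L q n x)⁻¹ * (bgT L U₀ n y' x)⁻¹ = (uLev L q (n + 1) y')⁻¹ := by
      have h2 : bgT L U₀ n y' x * uLev L q n x * (bgT L U₀ n y' x)⁻¹ = uLev L q (n + 1) y' :=
        Units.ext (by simpa only [Units.val_mul] using contourParallel_of_gaugeAct_eq L hq n y' x)
      rw [← h2, conj_inv]
    simpa only [Units.val_mul] using congrArg (fun g : 𝔸ˣ => (g : 𝔸)) h0
  have hbaseq : ∀ n, n < k → ∀ y' : LSite d, (uLev L q (n + 1) y')⁻¹ = (uLev L q n ((zdBlocking d L).base n y'))⁻¹ := by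
    intro n _ y'
    show (uLev L q (n + 1) y')⁻¹ = (uLev L q n (blockBase L y'))⁻¹
    rw [blockBase_eq_smul, uLev_smul]
  have hparp : ∀ n, n < k → ∀ y' : LSite d, ∀ x ∈ (zdBlocking d L).B n y',
      (bgT L U₀ n y' x : 𝔸) * ((uLev L p n x : 𝔸ˣ) : 𝔸) * (((bgT L U₀ n y' x)⁻¹ : 𝔸ˣ) : 𝔸) = ((uLev L p (n + 1) y' : 𝔸ˣ) : 𝔸) :=
    fun n hn y' x hx => contourParallel_of_inAx L k hL hax n hn y' x hx
  have hbasep : ∀ n, n < k → ∀ y' : LSite d, uLev L p (n + 1) y' = uLev L p n ((zdBlocking d L).base n y') := by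
    intro n _ y'
    show uLev L p (n + 1) y' = uLev L p n (blockBase L y')
    rw [blockBase_eq_smul, uLev_smul]
  have hF1 := Rbar_mul_parallel (zdBlocking d L) (bgT L U₀) k (u := fun x => ((uLev L p 0 x : 𝔸ˣ) : 𝔸)) (fun x => Units.isUnit _)
    (fun n x => (uLev L q n x)⁻¹) hparq hbaseq k le_rfl y
  have hF2 := Rbar_parallel (zdBlocking d L) (bgT L U₀) k (uLev L p) hparp hbasep k le_rfl y
  rw [hF1, hF2, ← Units.val_mul] at h1
  have h2 : uLev L p k y * (uLev L q k y)⁻¹ = 1 := Units.ext (by rw [h1, Units.val_one])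
  rw [uLev_apply, uLev_apply, ← hu] at h2
  exact h2

end Zd

/-! ## §4 At the T³ carrier: a (1.29)-restricted `u = p·k⁻¹` (`p • W` axial relative to `W`, `k ∈ Stab(W)`) is `1` at every `(K−n)`-centre, hence descends to `1` -/

section Torus

open scoped Matrix.Norms.L2Operator
open Literature.MathematicalPhysics.QuantumFieldTheory.Balaban1983to89.T3ContinuumYM3Torus
open T4Continuum
open B7Prop1Explicit renaming Site → LSite
open B15DeterminingSets (embIter)
open B10Eq27TorusAxialLog (pull unitsField toUField transl)
open B8Thm2SetupTorus (pullGauge pullGauge_apply toUGauge toUGauge_apply)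
open Literature.MathematicalPhysics.QuantumFieldTheory.Balaban1983to89.T3PrintedRegularOrbits (descTransf)
open B8Eq119TwistedAxial (InAx Restr129)
open B8Thm4TorusAt (torusLam)
open Summit.QuantumFields.YangMills.Theorems.Prop7SPrint (IsAxialPrint RestrictedPrint basePt)
open Summit.QuantumFields.YangMills.Theorems.Prop7AxialReprPrint (embIter_eq_transl pull_toUField_gaugeAct eq_one_of_pullGauge_eq)
open Summit.QuantumFields.YangMills.Theorems.Prop7TwistRegauge (descTransf_mul_inv_eq_one)

variable (F : T3Family) {n K : ℕ}

/-- ★★★★ **AT THE T³ CARRIER: A (1.29)-RESTRICTED `u = p·k⁻¹` WITH `p • W` AXIAL RELATIVE TO `W` AND `k ∈ Stab(W)` IS `1` AT EVERY `(K−n)`-CENTRE.**  The letters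
`RestrictedPrint`∕`IsAxialPrint` (✓`Prop7SPrintDefs`) are (1.29)∕(1.19) read on the pullbacks BASED at `x₀ = embIter (K−n) 0`; there `(p • W)♯ = (W♯)^{p♯}`
(✓`pull_toUField_gaugeAct`), `(k • W)♯ = W♯`, `u♯ = p♯·(k♯)⁻¹`, so §3 gives `u♯(Lᵏz) = 1` at every corner, and the corners ARE the centres (`embIter (K−n) y = x₀ + Lᵏ·ỹ`,
✓`embIter_eq_transl`). [cite: Balaban1985RegularSpaces, (1.29) p.81, (1.19) p.79, (1.14) p.78; Balaban1985Variational, (4) p.278; Balaban1987RG1, (0.1) p.251] -/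
theorem eq_one_embIter_of_restrictedPrint_split {W : GaugeField (F.P K) 0 (Matrix.specialUnitaryGroup (Fin 2) ℂ)}
    {u p k : GaugeTransf (F.P K) 0 (Matrix.specialUnitaryGroup (Fin 2) ℂ)}
    (hR : RestrictedPrint F n K W u) (hax : IsAxialPrint F n K W (GaugeField.gaugeAct p W)) (hk : GaugeField.gaugeAct k W = W)
    (hu : ∀ x, u x = p x * (k x)⁻¹) : ∀ y : Site (F.P K) (K - n), u (embIter (K - n) y) = 1 := by
  intro y
  have hkk : K - n ≤ (F.P K).m + (F.P K).K := by show K - n ≤ F.m + K; omega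
  have hL : 0 < (F.P K).L := by have := F.hL.2; show 0 < F.L; omega
  -- the based pullbacks
  set x₀ := basePt F n K with hx₀
  set W' : LSite (F.P K).d → Fin (F.P K).d → (Matrix (Fin 2) (Fin 2) ℂ)ˣ := pull (unitsField (toUField W)) x₀ with hW'
  set u' : LSite (F.P K).d → (Matrix (Fin 2) (Fin 2) ℂ)ˣ := pullGauge (fun x => Unitary.toUnits (toUGauge (F.P K) 2 u x)) x₀ with hu'
  set p' : LSite (F.P K).d → (Matrix (Fin 2) (Fin 2) ℂ)ˣ := pullGauge (fun x => Unitary.toUnits (toUGauge (F.P K) 2 p x)) x₀ with hp'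
  set k' : LSite (F.P K).d → (Matrix (Fin 2) (Fin 2) ℂ)ˣ := pullGauge (fun x => Unitary.toUnits (toUGauge (F.P K) 2 k x)) x₀ with hk'
  have hR' : Restr129 (F.P K).L (K - n) (torusLam (K - n)) W' u' := hR
  have hax' : InAx (F.P K).L (K - n) (torusLam (K - n)) W' (B7Prop1Explicit.gaugeAct p' W') := by
    have h := pull_toUField_gaugeAct p W x₀
    rw [← hW', ← hp'] at h
    rw [← h]; exact hax
  have hk'W : B7Prop1Explicit.gaugeAct k' W' = W' := by
    have h := pull_toUField_gaugeAct k W x₀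
    rw [hk, ← hW', ← hk'] at h
    exact h.symm
  have hu'eq : ∀ x, u' x = p' x * (k' x)⁻¹ := by
    intro x
    simp only [hu', hp', hk', pullGauge_apply, toUGauge_apply, hu, map_mul, map_inv]
  obtain ⟨off, hy⟩ : ∃ z : LSite (F.P K).d, embIter (K - n) y = transl x₀ ((((F.P K).L : ℤ) ^ (K - n)) • z) :=
    ⟨_, embIter_eq_transl hkk y⟩
  have hcorner := restr129_corner_eq_one (F.P K).L (K - n) hL hR' hax' hk'W hu'eq off
  rw [hy]
  exact eq_one_of_pullGauge_eq rfl hcorner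

/-- … hence such a `u` DESCENDS TO THE IDENTITY on the comparison lattice: `u↓ = 1` — `u` lies in print's group (4) (`descTransf` reads `u` at the `(K−n)`-centres,
✓`descTransf_mul_inv_eq_one`). [cite: Balaban1985Variational, (4) p.278; Balaban1985RegularSpaces, (1.29) p.81; Balaban1985Averaging, (12)-(13) p.19] -/
theorem descTransf_eq_one_of_restrictedPrint_split (hnK : n ≤ K) {W : GaugeField (F.P K) 0 (Matrix.specialUnitaryGroup (Fin 2) ℂ)}
    {u p k : GaugeTransf (F.P K) 0 (Matrix.specialUnitaryGroup (Fin 2) ℂ)}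
    (hR : RestrictedPrint F n K W u) (hax : IsAxialPrint F n K W (GaugeField.gaugeAct p W)) (hk : GaugeField.gaugeAct k W = W)
    (hu : ∀ x, u x = p x * (k x)⁻¹) : descTransf F n K hnK u = fun _ => 1 := by
  have h := descTransf_mul_inv_eq_one F hnK (g := u) (u := fun _ => (1 : Matrix.specialUnitaryGroup (Fin 2) ℂ))
    (fun y => by rw [eq_one_embIter_of_restrictedPrint_split F hR hax hk hu y])
  simpa using h

end Torus

end Summit.QuantumFields.YangMills.Theorems.FluctuationComparisonRegPrIntLS2BetaRestr129OfParallelSplit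
end
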